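/-
Copyright (c) 2026. All rights reserved.
Released under Apache 2.0 license as described in the file LICENSE.
Authors: abc-iut cell, prover seat abc-iut-L4-t5 (gen 10; row «F3757-PORT», abc-iut-L4-lead m147 (5)), over abc-iut-f-101's
`DiagramPathEmbeddings.lean` (`LiftPair`) / `DiagramSinkSystems.lean` (sink pre-families) and files 1–2 of this mover.
-/
import Literature.AnabelianGeometry.AbsoluteAnabelian.LogFrobeniusAnTelecorePaths
import Literature.AnabelianGeometry.AbsoluteAnabelian.LogFrobeniusAnTelecoreShapes
import HarnessLib

/-!
# [AbsTopIII] Cor 5.5 (iii), last sentence, inside `D_{An•}`: the member pairs of an observable read in the telecore diagram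
# (INNER pairs = the observable's own pairs; OUTER pairs = "lift at `An•[𝒳]`, then observable")

S. Mochizuki, *Topics in absolute anabelian geometry III: global reconstruction algorithms*,
J. Math. Sci. Univ. Tokyo 22 (2015) 939–1156 [MochizukiAbsTopIII2015]; manuscript `paper:url-5493eb38cbb7`, locators read on the
page: Def 3.5 (ii) p. 75 (families of homotopies: identity on the diagonal, composition, whiskering; "compatible" = contained in
ONE family), (iii) p. 75 (observables), (iv) p. 76 (telecores: boundary pairs `([γ₃]∘[γ₁], [γ₃]∘[γ₂])`), Cor 5.5 (ii) p. 130 (the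
telecore `𝔗_{An•}`, edges `φ_⋏ = φ_{An•}` back into the first rows), (iii) p. 131 ("the families of homotopies that constitute `S_log`
and `S_log⊞` are compatible with one another as well as with the families of homotopies that constitute the core and telecore
structures of (i), (ii)"), Rmk 3.5.1 p. 78 (structure functors).

WHAT (row «F3757-PORT», file 3b of the mover; the `D_{An•}`-specific half of abc-iut-f-101's sink-system method).  ONE family of
homotopies on `D_{An•}` containing the telecore family `𝒥` AND an observable `𝔖` with observation vertex `x` (`𝒩⊞_v` or `𝒩_v`) must
contain, besides the observable's own pairs read in `D_{An•}` (INNER pairs — abc-iut-f-101's `LiftPair`), every pair obtained from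
them by the saturation moves THROUGH the loops `x → … → An•[𝒳] →(φ_⋏) 𝒳_⋏ → … → x`: a telecore pair `([γ₃]∘[γ₁], [γ₃]∘[γ₂])` pushed
into `x` and composed with an observable pair.  These are the **OUTER pairs** `(a ; φ_⋏ ; u, b ; φ_⋏ ; u')` — `a, b` ANY two paths into
`An•[𝒳]`, ONE telecore edge `φ_⋏`, `(u, u')` a pair of the observable — with the homotopy "lift at `An•[𝒳]` (through the fully
faithful `κ_{An•}⁻¹`) whiskered by `φ_⋏ ; u`, THEN the observable's homotopy whiskered by `b ; φ_⋏`" (`OuterDec.hom`).  This file: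

* `headHom` — the lift at `An•[𝒳]` whiskered by a telecore edge — and its laws (`headHom_self/_trans/_precomp`, `isOver_headHom`);
* `OuterDec`, `OuterDec.hom`, `OuterDec.subsingleton` (the presentation is unique: file 2), the laws `hom_self`, `hom_trans`,
  `hom_precomp`, `isOver_hom`, and `OuterDec.ofHeads` / `hom_ofHeads` (the outer pair with diagonal observable part, through which
  pairs at `An•[𝒳]` are PUSHED into `x`, file 4);
(The generic shape lemmas and the inner pairs' pre-composition law without a sieve are in file 3a, `LogFrobeniusAnTelecoreShapes`.)

Pure category theory over abc-iut-L4-t2's honest Def. 3.5 definitions; nothing here bears on [IUTchIII] Cor. 3.12; no side taken.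
-/

set_option autoImplicit false

universe u

open CategoryTheory Quiver

namespace Literature.AnabelianGeometry.AbsoluteAnabelian

namespace LogFrobeniusSetting

open DiagramOfCategories

variable {Vmod : Type u} {isArc : Vmod → Bool} (L : LogFrobeniusSetting Vmod isArc)

/-! ## The head of an outer pair: the lift at `An•[𝒳]` whiskered by a telecore edge -/

section Head

/-- The one-edge path `[φ_⋏]`. [cite: MochizukiAbsTopIII2015, Cor 5.5 (ii) p. 130] -/
abbrev edgePath {x y : (anShape (Vmod := Vmod) (isArc := isArc)).Vertex} (j : x ⟶ y) : Path x y := Path.nil.cons j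

/-- The homotopy `lift(a, b) ▹ D_[φ_⋏] : D_[a ; φ_⋏] ⟶ D_[b ; φ_⋏]` (Def 3.5 (iv) (b) read at the first vertex after the telecore
edge; `a ; φ_⋏` is `a` composed with the one-edge path `[φ_⋏]`). [cite: MochizukiAbsTopIII2015, Definition 3.5 (iv) p.76] -/
noncomputable def headHom {x y : (anShape (Vmod := Vmod) (isArc := isArc)).Vertex}
    (a b : Path x (anShape (Vmod := Vmod) (isArc := isArc)).obs) (j : (anShape (Vmod := Vmod) (isArc := isArc)).obs ⟶ y) :
    L.anDiagram.pathFunctor (a.comp (edgePath j)) ⟶ L.anDiagram.pathFunctor (b.comp (edgePath j)) :=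
  eqToHom (L.anDiagram.pathFunctor_comp a (edgePath j)) ≫
    Functor.whiskerRight (L.anOverE.lift L.anOverE_ff_obs a b) (L.anDiagram.pathFunctor (edgePath j)) ≫
    eqToHom (L.anDiagram.pathFunctor_comp b (edgePath j)).symm

/-- The head homotopy lies over `Th•[Z]` (the lift does, and post-whiskering preserves over-ness — abc-iut-f-101's
`IsOver.whiskerRight`). [cite: MochizukiAbsTopIII2015, Remark 3.5.1 p.78] -/
theorem isOver_headHom {x y : (anShape (Vmod := Vmod) (isArc := isArc)).Vertex}
    (a b : Path x (anShape (Vmod := Vmod) (isArc := isArc)).obs) (j : (anShape (Vmod := Vmod) (isArc := isArc)).obs ⟶ y) :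
    L.anOverE.IsOver (a.comp (edgePath j)) (b.comp (edgePath j)) (L.headHom a b j) :=
  (OverData.isOver_lift (O := L.anOverE) L.anOverE_ff_obs a b).whiskerRight (edgePath j)

/-- The head homotopy of a diagonal pair is the identity (`ζ_{([γ],[γ])} = id`). [cite: MochizukiAbsTopIII2015, Definition 3.5 (ii) p.75] -/
theorem headHom_self {x y : (anShape (Vmod := Vmod) (isArc := isArc)).Vertex}
    (a : Path x (anShape (Vmod := Vmod) (isArc := isArc)).obs) (j : (anShape (Vmod := Vmod) (isArc := isArc)).obs ⟶ y) :
    L.headHom a a j = 𝟙 _ := by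
  rw [headHom, OverData.lift_self, Functor.whiskerRight_id', Category.id_comp, eqToHom_trans, eqToHom_refl]

/-- The head homotopies compose (`lift_trans`). [cite: MochizukiAbsTopIII2015, Definition 3.5 (ii) p.75] -/
theorem headHom_trans {x y : (anShape (Vmod := Vmod) (isArc := isArc)).Vertex}
    (a b b₂ : Path x (anShape (Vmod := Vmod) (isArc := isArc)).obs) (j : (anShape (Vmod := Vmod) (isArc := isArc)).obs ⟶ y) :
    L.headHom a b j ≫ L.headHom b b₂ j = L.headHom a b₂ j := by
  simp only [headHom, Category.assoc, eqToHom_trans_assoc, eqToHom_refl, Category.id_comp]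
  rw [← Category.assoc (Functor.whiskerRight _ _), ← Functor.whiskerRight_comp, OverData.lift_trans]

/-- The head homotopy of a pre-composed pair is the pre-whiskered head homotopy (`lift_precomp_heq`), in conjugated form.
[cite: MochizukiAbsTopIII2015, Definition 3.5 (ii) p.75] -/
theorem headHom_precomp {x' x y : (anShape (Vmod := Vmod) (isArc := isArc)).Vertex} (r : Path x' x)
    (a b : Path x (anShape (Vmod := Vmod) (isArc := isArc)).obs) (j : (anShape (Vmod := Vmod) (isArc := isArc)).obs ⟶ y)
    (e₁ : L.anDiagram.pathFunctor ((r.comp a).comp (edgePath j)) =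
      L.anDiagram.pathFunctor r ⋙ L.anDiagram.pathFunctor (a.comp (edgePath j)))
    (e₂ : L.anDiagram.pathFunctor ((r.comp b).comp (edgePath j)) =
      L.anDiagram.pathFunctor r ⋙ L.anDiagram.pathFunctor (b.comp (edgePath j))) :
    L.headHom (r.comp a) (r.comp b) j =
      eqToHom e₁ ≫ Functor.whiskerLeft (L.anDiagram.pathFunctor r) (L.headHom a b j) ≫ eqToHom e₂.symm := by
  have hl : L.anOverE.lift L.anOverE_ff_obs (r.comp a) (r.comp b) =
      eqToHom (L.anDiagram.pathFunctor_comp r a) ≫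
        Functor.whiskerLeft (L.anDiagram.pathFunctor r) (L.anOverE.lift L.anOverE_ff_obs a b) ≫
        eqToHom (L.anDiagram.pathFunctor_comp r b).symm :=
    eq_conj_of_heq (OverData.lift_precomp_heq (O := L.anOverE) L.anOverE_ff_obs r a b) _ _
  rw [headHom, hl, headHom]
  exact whiskerRight_conj_whiskerLeft (L.anDiagram.pathFunctor r) (L.anOverE.lift L.anOverE_ff_obs a b)
    (L.anDiagram.pathFunctor (edgePath j)) (L.anDiagram.pathFunctor_comp r a) (L.anDiagram.pathFunctor_comp r b)
    (L.anDiagram.pathFunctor_comp (r.comp a) (edgePath j)) (L.anDiagram.pathFunctor_comp (r.comp b) (edgePath j))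
    (L.anDiagram.pathFunctor_comp a (edgePath j)) (L.anDiagram.pathFunctor_comp b (edgePath j)) e₁ e₂

end Head

section Sink

variable (P : DVertex Vmod isArc → Prop) (xs : DVertex Vmod isArc) (hP : ∀ ⦃a : DVertex Vmod isArc⦄, P a → InFive (isArc := isArc) a)
  (hxs : InFive (isArc := isArc) xs)
  (H : (L.anDiagram.comapAlong (embObs P xs hP hxs)).HomotopyFamily)

/-! ## Outer pairs -/

/-- **An outer pair** of the observable read in `D_{An•}`: a presentation `(a ; φ_⋏ ; u, b ; φ_⋏ ; u')` of a pair of paths into the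
observation vertex `x` — `a, b` paths into `An•[𝒳]`, ONE telecore edge `φ_⋏` into `𝒳_⋏ ∈ D_{≤P}`, and a member pair `(u, u')` of the
observable out of `𝒳_⋏` (Def 3.5 (ii) "compatible": these pairs are forced into any family containing `𝒥` and the observable).
[cite: MochizukiAbsTopIII2015, Cor 5.5 (iii) p. 131] -/
structure OuterDec {x : (anShape (Vmod := Vmod) (isArc := isArc)).Vertex}
    (Pth Qth : Path x ((embObs P xs hP hxs).obj (obsShape P xs).obs)) : Type u where
  /-- the left head, into `An•[𝒳]` -/
  a : Path x (anShape (Vmod := Vmod) (isArc := isArc)).obs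
  /-- the right head, into `An•[𝒳]` -/
  b : Path x (anShape (Vmod := Vmod) (isArc := isArc)).obs
  /-- the vertex `𝒳_⋏` entered by the telecore edge -/
  c : DVertex Vmod isArc
  hc : P c
  /-- the telecore edge `φ_⋏` -/
  j : (anShape (Vmod := Vmod) (isArc := isArc)).obs ⟶ (anShape (Vmod := Vmod) (isArc := isArc)).base ⟨c, hP hc⟩
  /-- the left observable path -/
  u : Path ((obsShape P xs).base ⟨c, hc⟩) (obsShape P xs).obs
  /-- the right observable path -/
  u' : Path ((obsShape P xs).base ⟨c, hc⟩) (obsShape P xs).obs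
  mem : H.E u u'
  left_eq : Pth = (a.comp (edgePath j)).comp ((embObs P xs hP hxs).mapPath u)
  right_eq : Qth = (b.comp (edgePath j)).comp ((embObs P xs hP hxs).mapPath u')

namespace OuterDec

variable {L P xs hP hxs H}

/-- `a ; φ_⋏ ; u = (a ; φ_⋏) ; u` is also `a.cons φ_⋏` composed with `u` (the form of file 2). [cite: MochizukiAbsTopIII2015, Section 0 p.26] -/
theorem comp_edgePath_comp {x : (anShape (Vmod := Vmod) (isArc := isArc)).Vertex} (a : Path x (anShape (Vmod := Vmod) (isArc := isArc)).obs)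
    {c : DVertex Vmod isArc} {hc : P c}
    (j : (anShape (Vmod := Vmod) (isArc := isArc)).obs ⟶ (anShape (Vmod := Vmod) (isArc := isArc)).base ⟨c, hP hc⟩)
    {b : (obsShape P xs).Vertex} (u : Path ((obsShape P xs).base ⟨c, hc⟩) b) :
    (a.comp (edgePath j)).comp ((embObs P xs hP hxs).mapPath u) = (a.cons j).comp ((embObs P xs hP hxs).mapPath u) := rfl

/-- Two outer presentations of the same LEFT path agree in their left data. [cite: MochizukiAbsTopIII2015, Section 0 p.26] -/
theorem left_unique (hnot : ¬ P xs) {x : (anShape (Vmod := Vmod) (isArc := isArc)).Vertex}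
    (a a' : Path x (anShape (Vmod := Vmod) (isArc := isArc)).obs) {c c' : DVertex Vmod isArc} {hc : P c} {hc' : P c'}
    (j : (anShape (Vmod := Vmod) (isArc := isArc)).obs ⟶ (anShape (Vmod := Vmod) (isArc := isArc)).base ⟨c, hP hc⟩)
    (j' : (anShape (Vmod := Vmod) (isArc := isArc)).obs ⟶ (anShape (Vmod := Vmod) (isArc := isArc)).base ⟨c', hP hc'⟩)
    (u : Path ((obsShape P xs).base ⟨c, hc⟩) (obsShape P xs).obs) (u₂ : Path ((obsShape P xs).base ⟨c', hc'⟩) (obsShape P xs).obs)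
    (h : (a.comp (edgePath j)).comp ((embObs P xs hP hxs).mapPath u) = (a'.comp (edgePath j')).comp ((embObs P xs hP hxs).mapPath u₂)) :
    a = a' ∧ c = c' ∧ HEq j j' ∧ HEq u u₂ := by
  rw [comp_edgePath_comp, comp_edgePath_comp] at h
  have s := (lastSplit_outerPath P xs hP hxs a j u).symm.trans ((congrArg _ h).trans (lastSplit_outerPath P xs hP hxs a' j' u₂))
  simp only [Option.some.injEq, Prod.mk.injEq] at s
  obtain ⟨rfl, t⟩ := s
  obtain ⟨rfl, hj, hu⟩ := outerTail_injective P xs hP hxs hnot j u j' u₂ t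
  exact ⟨rfl, rfl, hj, hu⟩

/-- **The presentation of an outer pair is unique** (file 2: the last visit of `An•[𝒳]` and the tail after it are determined).
[cite: MochizukiAbsTopIII2015, Section 0 p.26] -/
theorem subsingleton (hnot : ¬ P xs) {x : (anShape (Vmod := Vmod) (isArc := isArc)).Vertex}
    {Pth Qth : Path x ((embObs P xs hP hxs).obj (obsShape P xs).obs)} (d d' : OuterDec L P xs hP hxs H Pth Qth) : d = d' := by
  obtain ⟨a, b, c, hc, j, u, u', m, hl, hr⟩ := d
  obtain ⟨a', b', c', hc', j', u₂, u₂', m', hl', hr'⟩ := d'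
  obtain ⟨rfl, rfl, hj, hu⟩ := left_unique hnot a a' j j' u u₂ (hl.symm.trans hl')
  cases hj; cases hu
  obtain ⟨rfl, -, -, hu'⟩ := left_unique hnot b b' j j u' u₂' (hr.symm.trans hr')
  cases hu'
  rfl

/-- The observable's homotopy of the pair `(u, u')`, read on the path functors of `D_{An•}` (abc-iut-f-101's `LiftPair.ofMem … |>.hom`:
`(F^*D)_[γ] = D_[F γ]`). [cite: MochizukiAbsTopIII2015, Definition 3.5 (ii) p.75] -/
noncomputable def tailHom {x : (anShape (Vmod := Vmod) (isArc := isArc)).Vertex}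
    {Pth Qth : Path x ((embObs P xs hP hxs).obj (obsShape P xs).obs)} (d : OuterDec L P xs hP hxs H Pth Qth) :
    L.anDiagram.pathFunctor ((embObs P xs hP hxs).mapPath d.u) ⟶ L.anDiagram.pathFunctor ((embObs P xs hP hxs).mapPath d.u') :=
  (LiftPair.ofMem (F := embObs P xs hP hxs) (D := L.anDiagram) d.mem).hom

/-- **The homotopy of an outer pair**: `(lift(a, b) ▹ D_[φ_⋏ ; u]) ≫ (D_[b ; φ_⋏] ◃ ζ_{(u,u')})`.
[cite: MochizukiAbsTopIII2015, Definition 3.5 (ii) p.75] -/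
noncomputable def hom {x : (anShape (Vmod := Vmod) (isArc := isArc)).Vertex}
    {Pth Qth : Path x ((embObs P xs hP hxs).obj (obsShape P xs).obs)} (d : OuterDec L P xs hP hxs H Pth Qth) :
    L.anDiagram.pathFunctor Pth ⟶ L.anDiagram.pathFunctor Qth :=
  eqToHom (L.anDiagram.pathFunctor_eq_of_eq_comp _ _ d.left_eq) ≫
    (Functor.whiskerRight (L.headHom d.a d.b d.j) (L.anDiagram.pathFunctor ((embObs P xs hP hxs).mapPath d.u)) ≫
      Functor.whiskerLeft (L.anDiagram.pathFunctor (d.b.comp (edgePath d.j))) d.tailHom) ≫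
    eqToHom (L.anDiagram.pathFunctor_eq_of_eq_comp _ _ d.right_eq).symm

/-- The tail homotopies of composable presentations compose (Def 3.5 (ii), second axiom, for the observable).
[cite: MochizukiAbsTopIII2015, Definition 3.5 (ii) p.75] -/
theorem tailHom_ofMem_trans {c : DVertex Vmod isArc} {hc : P c} {u u' u'' : Path ((obsShape P xs).base ⟨c, hc⟩) (obsShape P xs).obs}
    (m₁ : H.E u u') (m₂ : H.E u' u'') :
    (LiftPair.ofMem (F := embObs P xs hP hxs) (D := L.anDiagram) m₁).hom ≫
        (LiftPair.ofMem (F := embObs P xs hP hxs) (D := L.anDiagram) m₂).hom =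
      (LiftPair.ofMem (F := embObs P xs hP hxs) (D := L.anDiagram) (H.isSaturated.trans m₁ m₂)).hom := by
  rw [LiftPair.hom_ofMem, LiftPair.hom_ofMem, LiftPair.hom_ofMem, H.η_trans m₁ m₂]
  simp

/-- The tail homotopy of a diagonal presentation is the identity. [cite: MochizukiAbsTopIII2015, Definition 3.5 (ii) p.75] -/
theorem tailHom_ofMem_self {c : DVertex Vmod isArc} {hc : P c} {u : Path ((obsShape P xs).base ⟨c, hc⟩) (obsShape P xs).obs}
    (m : H.E u u) : (LiftPair.ofMem (F := embObs P xs hP hxs) (D := L.anDiagram) m).hom = 𝟙 _ := by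
  rw [LiftPair.hom_ofMem, H.η_refl m]
  simp

/-- **Identity on the diagonal**: an outer presentation of a pair `(γ, γ)` has trivial homotopy (the two heads and the two tails
coincide by uniqueness; `lift_self`, `η_refl`). [cite: MochizukiAbsTopIII2015, Definition 3.5 (ii) p.75] -/
theorem hom_self (hnot : ¬ P xs) {x : (anShape (Vmod := Vmod) (isArc := isArc)).Vertex}
    {Pth : Path x ((embObs P xs hP hxs).obj (obsShape P xs).obs)} (d : OuterDec L P xs hP hxs H Pth Pth) : d.hom = 𝟙 _ := by
  obtain ⟨a, b, c, hc, j, u, u', m, hl, hr⟩ := d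
  obtain ⟨rfl, -, -, hu⟩ := left_unique hnot a b j j u u' (hl.symm.trans hr)
  cases hu
  rw [hom, tailHom]
  dsimp only
  rw [tailHom_ofMem_self, headHom_self]
  exact outerShape_id (L.anDiagram.pathFunctor_eq_of_eq_comp _ _ hl) (L.anDiagram.pathFunctor_eq_of_eq_comp _ _ hr)

/-- **Composition**: outer presentations of `(γ₁, γ₂)` and `(γ₂, γ₃)` give one of `(γ₁, γ₃)` whose homotopy is the composite (the middle
heads and tails coincide by uniqueness; then `headHom_trans`, the observable's `η_trans`, and naturality of the observable's homotopy
against the lift — `outerShape_comp`). [cite: MochizukiAbsTopIII2015, Definition 3.5 (ii) p.75] -/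
theorem hom_trans (hnot : ¬ P xs) {x : (anShape (Vmod := Vmod) (isArc := isArc)).Vertex}
    {Pth Qth Rth : Path x ((embObs P xs hP hxs).obj (obsShape P xs).obs)} (d₁ : OuterDec L P xs hP hxs H Pth Qth)
    (d₂ : OuterDec L P xs hP hxs H Qth Rth) : ∃ d₃ : OuterDec L P xs hP hxs H Pth Rth, d₃.hom = d₁.hom ≫ d₂.hom := by
  obtain ⟨a, b, c, hc, j, u, u', m₁, hl, hr⟩ := d₁
  obtain ⟨a₂, b₂, c₂, hc₂, j₂, u₂, u₂', m₂, hl₂, hr₂⟩ := d₂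
  obtain ⟨rfl, rfl, hj, hu⟩ := left_unique hnot b a₂ j j₂ u' u₂ (hr.symm.trans hl₂)
  cases hj; cases hu
  refine ⟨⟨a, b₂, c, hc, j, u, u₂', H.isSaturated.trans m₁ m₂, hl, hr₂⟩, ?_⟩
  rw [hom, hom, hom, tailHom, tailHom, tailHom]
  dsimp only
  rw [← tailHom_ofMem_trans, ← L.headHom_trans a b b₂ j]
  symm
  exact outerShape_comp (L.headHom a b j) (L.headHom b b₂ j)
    (LiftPair.ofMem (F := embObs P xs hP hxs) (D := L.anDiagram) m₁).hom
    (LiftPair.ofMem (F := embObs P xs hP hxs) (D := L.anDiagram) m₂).hom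
    (L.anDiagram.pathFunctor_eq_of_eq_comp _ _ hl) (L.anDiagram.pathFunctor_eq_of_eq_comp _ _ hr)
    (L.anDiagram.pathFunctor_eq_of_eq_comp _ _ hl₂) (L.anDiagram.pathFunctor_eq_of_eq_comp _ _ hr₂)

/-- **Pre-whiskering**: an outer presentation of `(γ₁, γ₂)` pre-composed with ANY path `r` of `D_{An•}` is an outer presentation (heads
`r ∘ a`, `r ∘ b`), with the pre-whiskered homotopy (`headHom_precomp`, `whiskerLeft_outerShape`).
[cite: MochizukiAbsTopIII2015, Definition 3.5 (ii) p.75] -/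
theorem hom_precomp {x' x : (anShape (Vmod := Vmod) (isArc := isArc)).Vertex} (r : Path x' x)
    {Pth Qth : Path x ((embObs P xs hP hxs).obj (obsShape P xs).obs)} (d : OuterDec L P xs hP hxs H Pth Qth) :
    ∃ d' : OuterDec L P xs hP hxs H (r.comp Pth) (r.comp Qth),
      d'.hom = eqToHom (L.anDiagram.pathFunctor_comp r Pth) ≫ Functor.whiskerLeft (L.anDiagram.pathFunctor r) d.hom ≫
        eqToHom (L.anDiagram.pathFunctor_comp r Qth).symm := by
  obtain ⟨a, b, c, hc, j, u, u', m, hl, hr⟩ := d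
  subst hl hr
  refine ⟨⟨r.comp a, r.comp b, c, hc, j, u, u', m, by simp only [Path.comp_assoc], by simp only [Path.comp_assoc]⟩, ?_⟩
  rw [hom, hom, tailHom, tailHom]
  dsimp only
  have eS₀ : L.anDiagram.pathFunctor ((r.comp a).comp (edgePath j)) =
      L.anDiagram.pathFunctor r ⋙ L.anDiagram.pathFunctor (a.comp (edgePath j)) := by rw [Path.comp_assoc, pathFunctor_comp]
  have eS : L.anDiagram.pathFunctor ((r.comp b).comp (edgePath j)) =
      L.anDiagram.pathFunctor r ⋙ L.anDiagram.pathFunctor (b.comp (edgePath j)) := by rw [Path.comp_assoc, pathFunctor_comp]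
  rw [L.headHom_precomp r a b j eS₀ eS]
  symm
  exact whiskerLeft_outerShape (L.anDiagram.pathFunctor r) (L.headHom a b j)
    (LiftPair.ofMem (F := embObs P xs hP hxs) (D := L.anDiagram) m).hom (L.anDiagram.pathFunctor_eq_of_eq_comp _ _ rfl)
    (L.anDiagram.pathFunctor_eq_of_eq_comp _ _ rfl) (L.anDiagram.pathFunctor_comp r _) (L.anDiagram.pathFunctor_comp r _) eS₀ eS
    (L.anDiagram.pathFunctor_eq_of_eq_comp _ _ (by simp only [Path.comp_assoc]))
    (L.anDiagram.pathFunctor_eq_of_eq_comp _ _ (by simp only [Path.comp_assoc]))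

/-- **Outer homotopies lie over `Th•[Z]`**, as soon as the observable's own homotopies do (head: `isOver_headHom`; tail: the hypothesis;
whiskering and composition preserve over-ness). [cite: MochizukiAbsTopIII2015, Remark 3.5.1 p.78] -/
theorem isOver_hom
    (hover : ∀ {a' : (obsShape P xs).Vertex} (p q : Path a' (obsShape P xs).obs) (h : H.E p q),
      L.anOverE.IsOver ((embObs P xs hP hxs).mapPath p) ((embObs P xs hP hxs).mapPath q) (LiftPair.ofMem (D := L.anDiagram) h).hom)
    {x : (anShape (Vmod := Vmod) (isArc := isArc)).Vertex} {Pth Qth : Path x ((embObs P xs hP hxs).obj (obsShape P xs).obs)}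
    (d : OuterDec L P xs hP hxs H Pth Qth) : L.anOverE.IsOver Pth Qth d.hom := by
  obtain ⟨a, b, c, hc, j, u, u', m, hl, hr⟩ := d
  subst hl hr
  have h₁ := (L.isOver_headHom a b j).whiskerRight ((embObs P xs hP hxs).mapPath u)
  have h₂ := (hover u u' m).whiskerLeft (b.comp (edgePath j))
  have key : (⟨a, b, c, hc, j, u, u', m, rfl, rfl⟩ : OuterDec L P xs hP hxs H _ _).hom =
      (eqToHom (L.anDiagram.pathFunctor_comp _ _) ≫
          Functor.whiskerRight (L.headHom a b j) (L.anDiagram.pathFunctor ((embObs P xs hP hxs).mapPath u)) ≫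
          eqToHom (L.anDiagram.pathFunctor_comp _ _).symm) ≫
        (eqToHom (L.anDiagram.pathFunctor_comp _ _) ≫
          Functor.whiskerLeft (L.anDiagram.pathFunctor (b.comp (edgePath j)))
            (LiftPair.ofMem (F := embObs P xs hP hxs) (D := L.anDiagram) m).hom ≫
          eqToHom (L.anDiagram.pathFunctor_comp _ _).symm) := by
    rw [hom, tailHom]
    dsimp only
    symm
    exact outerShape_split (L.headHom a b j) (LiftPair.ofMem (F := embObs P xs hP hxs) (D := L.anDiagram) m).hom
      (L.anDiagram.pathFunctor_comp _ _) (L.anDiagram.pathFunctor_comp _ _) (L.anDiagram.pathFunctor_comp _ _)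
      (L.anDiagram.pathFunctor_comp _ _)
  rw [key]
  exact h₁.comp h₂

/-- **The outer pair with diagonal observable part** `(A ; φ_⋏ ; u, B ; φ_⋏ ; u)` — through it a pair `(A, B)` at `An•[𝒳]` is PUSHED into
the observation vertex along `φ_⋏ ; u` (Def 3.5 (iv) (b) read at `x`). [cite: MochizukiAbsTopIII2015, Definition 3.5 (iv) p.76] -/
def ofHeads {x : (anShape (Vmod := Vmod) (isArc := isArc)).Vertex} (A B : Path x (anShape (Vmod := Vmod) (isArc := isArc)).obs)
    (c : DVertex Vmod isArc) (hc : P c)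
    (j : (anShape (Vmod := Vmod) (isArc := isArc)).obs ⟶ (anShape (Vmod := Vmod) (isArc := isArc)).base ⟨c, hP hc⟩)
    (u : Path ((obsShape P xs).base ⟨c, hc⟩) (obsShape P xs).obs) (hu : H.E u u) :
    OuterDec L P xs hP hxs H ((A.comp (edgePath j)).comp ((embObs P xs hP hxs).mapPath u))
      ((B.comp (edgePath j)).comp ((embObs P xs hP hxs).mapPath u)) :=
  ⟨A, B, c, hc, j, u, u, hu, rfl, rfl⟩

/-- Its homotopy is the head homotopy whiskered by the tail `D_[φ_⋏ ; u]` (the observable part is the identity).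
[cite: MochizukiAbsTopIII2015, Definition 3.5 (iv) p.76] -/
theorem hom_ofHeads {x : (anShape (Vmod := Vmod) (isArc := isArc)).Vertex} (A B : Path x (anShape (Vmod := Vmod) (isArc := isArc)).obs)
    (c : DVertex Vmod isArc) (hc : P c)
    (j : (anShape (Vmod := Vmod) (isArc := isArc)).obs ⟶ (anShape (Vmod := Vmod) (isArc := isArc)).base ⟨c, hP hc⟩)
    (u : Path ((obsShape P xs).base ⟨c, hc⟩) (obsShape P xs).obs) (hu : H.E u u) :
    (ofHeads A B c hc j u hu).hom =
      eqToHom (L.anDiagram.pathFunctor_comp _ _) ≫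
        Functor.whiskerRight (L.headHom A B j) (L.anDiagram.pathFunctor ((embObs P xs hP hxs).mapPath u)) ≫
        eqToHom (L.anDiagram.pathFunctor_comp _ _).symm := by
  rw [hom, tailHom]
  dsimp only [ofHeads]
  rw [tailHom_ofMem_self]
  exact outerShape_tail_id _ (L.anDiagram.pathFunctor_comp _ _) (L.anDiagram.pathFunctor_comp _ _)

end OuterDec

end Sink

end LogFrobeniusSetting

end Literature.AnabelianGeometry.AbsoluteAnabelian
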